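import Mathlib
import HarnessLib
import Literature.MathematicalPhysics.KineticTheory.HardSphereEuler
import Literature.MathematicalPhysics.KineticTheory.BackwardCluster
import Summits.AtomisticToContinuum.HydrodynamicLimit.Theses.RelayRaceLocality
import Summits.AtomisticToContinuum.HydrodynamicLimit.Theorems.RelayRaceLocalityGibbsLightConeOfSeams

/-!
# Crux `RelayRaceLocality.GibbsLightCone` (stmt-AtomisticToContinuum-12501) — the two seams as named `Prop`s,
ready to file as items (lead c5 workfile; elaborates, 0 sorries)

For the planner. `SlabContactNecklaceSeamTwoLe` (X″ from two links on) and `TiltedSlabContactNecklaceSeam` (Y″) are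
VERBATIM the two registered stub signatures of `Lines/Sketch.lean` rev 15; `gibbsLightCone_of_seamDefs` is the landed
conditional closure `gibbsLightCone_of_seams` (p134911) restated over the named Props, so that two statement items with
these bodies close the crux by a one-line term. Both are beyond-Lanford dynamical statements at fixed reduced density
(see `Lines/SketchDead.md`): file them `@[conjecture]` / `[difficulty: open-problem]`, not as prover targets.
`GibbsLightConeLogLoss` is the weaker neighbour reachable with printed tools (Pulvirenti–Simonella 2021 late-foot IBF
bound + invariance + the landed window bookkeeping), recorded as a candidate separate target; it is NOT the crux and needs
the k-creation IBF Liouville identity formalised over `HardSphereFlow` first.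
-/

namespace Summit.AtomisticToContinuum.HydrodynamicLimit.Cruxes.GibbsLightCone.Seams

open Literature.MathematicalPhysics.KineticTheory Literature.Analysis.FluidPDE MeasureTheory Filter Set

open scoped ENNReal

/-- **Seam X″ (n ≥ 2), multi-slab contact necklace bound.** Under the invariant Gibbs law of `N+1` hard spheres at
reduced density `σ`, along an injective label chain of `n ≥ 2` links with ordered slab start times inside a window of
`M ≤ K log(N+2)` mean free times, the probability that every consecutive pair is in contact at some time of its slab
(width `Δ ≤ ε_N/√θ`) is at most `(C₁ (ε_N + Λ√θΔ)³)ⁿ`, eventually in `N`, constants fixed before `σ`. Equivalent (n = 2)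
to a Palm-conditional collision-intensity bound; true for the non-interacting gas; no theorem at fixed reduced density. -/
def SlabContactNecklaceSeamTwoLe : Prop :=
    ∀ a θ : ℝ, 0 < a → 0 < θ → ∃ σ₀ : ℝ, 0 < σ₀ ∧ ∃ C₁ Λ : ℝ, 0 ≤ C₁ ∧ 1 ≤ Λ ∧ ∀ K : ℝ, 0 < K →
      ∀ σ : ℝ, 0 < σ → σ < σ₀ →
      ∀ Φ : (N : ℕ) → HardSphereFlow (Torus.geometry (Fin 3)) (hsDiameter σ N) (N + 1),
      ∀ᶠ N : ℕ in atTop, ∀ M : ℝ, 1 ≤ M → M ≤ K * Real.log ((N : ℝ) + 2) →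
        ∀ Δ : ℝ, 0 < Δ → Δ ≤ hsDiameter σ N / Real.sqrt θ →
        ∀ (n : ℕ) (q : Fin (n + 1) → Fin (N + 1)) (T : Fin (n + 2) → ℝ), 2 ≤ n →
          Function.Injective q → Monotone T → T 0 = 0 →
          T (Fin.last (n + 1)) = M * (((N + 1 : ℕ) : ℝ) ^ (-(1 / 3 : ℝ)) / σ ^ 2 / Real.sqrt θ) →
        localGibbsLaw σ (fun _ => a) (fun _ => 0) (fun _ => θ) N (Φ N)
          {z | ∀ m : Fin n, ∃ u ∈ Set.Icc (T (Fin.castSucc (Fin.succ m))) (T (Fin.castSucc (Fin.succ m)) + Δ),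
              s(q (Fin.castSucc m), q (Fin.succ m)) ∈
                contactPairSet (Torus.geometry (Fin 3)) (hsDiameter σ N) ((Φ N).flow u z)}
          ≤ ENNReal.ofReal ((C₁ * (hsDiameter σ N + Λ * Real.sqrt θ * Δ) ^ 3) ^ n)

/-- **Seam Y″, hot-tilted multi-slab contact necklace bound.** The event of X″ together with a hot path length (speed
above `A√θ`) of the carriers exceeding `y ℓ_N` costs an extra factor `C₂ e^{c₂M} e^{-ηy}`. Its `n = 0` slice is hot-flight
survival damping for one tagged sphere (false for free flight: `hotFlightDamping_false_without_posDiameter`). -/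
def TiltedSlabContactNecklaceSeam : Prop :=
    ∀ a θ : ℝ, 0 < a → 0 < θ → ∃ σ₀ : ℝ, 0 < σ₀ ∧ ∃ A η C₁ Λ c₂ C₂ : ℝ, 0 ≤ A ∧ 0 < η ∧ 1 ≤ Λ ∧
      ∀ K : ℝ, 0 < K →
      ∀ σ : ℝ, 0 < σ → σ < σ₀ →
      ∀ Φ : (N : ℕ) → HardSphereFlow (Torus.geometry (Fin 3)) (hsDiameter σ N) (N + 1),
      ∀ᶠ N : ℕ in atTop, ∀ M : ℝ, 1 ≤ M → M ≤ K * Real.log ((N : ℝ) + 2) →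
        ∀ Δ : ℝ, 0 < Δ → Δ ≤ hsDiameter σ N / Real.sqrt θ →
        ∀ (n : ℕ) (q : Fin (n + 1) → Fin (N + 1)) (T : Fin (n + 2) → ℝ),
          Function.Injective q → Monotone T → T 0 = 0 →
          T (Fin.last (n + 1)) = M * (((N + 1 : ℕ) : ℝ) ^ (-(1 / 3 : ℝ)) / σ ^ 2 / Real.sqrt θ) →
        ∀ y : ℝ, 0 ≤ y →
        localGibbsLaw σ (fun _ => a) (fun _ => 0) (fun _ => θ) N (Φ N)
          {z | (∀ m : Fin n, ∃ u ∈ Set.Icc (T (Fin.castSucc (Fin.succ m))) (T (Fin.castSucc (Fin.succ m)) + Δ),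
              s(q (Fin.castSucc m), q (Fin.succ m)) ∈
                contactPairSet (Torus.geometry (Fin 3)) (hsDiameter σ N) ((Φ N).flow u z)) ∧
              y * (((N + 1 : ℕ) : ℝ) ^ (-(1 / 3 : ℝ)) / σ ^ 2) <
                ∑ m : Fin (n + 1), ∫ u in T (Fin.castSucc m)..(T (Fin.succ m) + Δ),
                  (if A * Real.sqrt θ < ‖(((Φ N).flow u z) (q m)).2‖ then
                    ‖(((Φ N).flow u z) (q m)).2‖ else 0)}
          ≤ ENNReal.ofReal (C₂ * (C₁ * (hsDiameter σ N + Λ * Real.sqrt θ * Δ) ^ 3) ^ n *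
              Real.exp (c₂ * M) * Real.exp (-η * y))

/-- The crux from the two named seams (the landed `gibbsLightCone_of_seams`, p134911). -/
theorem gibbsLightCone_of_seamDefs (hX : SlabContactNecklaceSeamTwoLe) (hY : TiltedSlabContactNecklaceSeam) :
    Summit.AtomisticToContinuum.HydrodynamicLimit.Theses.RelayRaceLocality.GibbsLightCone :=
  Summit.AtomisticToContinuum.HydrodynamicLimit.Theorems.LogWindowTaggedTail.gibbsLightCone_of_seams hX hY

/-- **Log-loss cone (candidate weaker target, NOT the crux).** Same as `GibbsLightCone` with the cone radius
`c √(log (N+2)) t + δ` in place of `c t + δ`: the reach of late-foot IBF enumeration over Lanford-short sub-windows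
(`(N+1)·t/(c₀τ_N) ≍ N^{4/3}` union terms, single-window tail `e^{-cλ²}`). -/
def GibbsLightConeLogLoss : Prop :=
  ∀ a θ : ℝ, 0 < a → 0 < θ → ∃ σ₀ : ℝ, 0 < σ₀ ∧ ∃ c : ℝ, 0 < c ∧ ∀ σ : ℝ, 0 < σ → σ < σ₀ →
    ∀ Φ : (N : ℕ) → HardSphereFlow (Torus.geometry (Fin 3)) (hsDiameter σ N) (N + 1),
    ∀ t : ℝ, 0 ≤ t → ∀ δ : ℝ, 0 < δ →
      Tendsto (fun N => localGibbsLaw σ (fun _ => a) (fun _ => 0) (fun _ => θ) N (Φ N)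
        {z | ∃ i j : Fin (N + 1), (j = i ∨ j ∈ (Φ N).backwardCluster i 0 t z) ∧
          c * Real.sqrt (Real.log ((N : ℝ) + 2)) * t + δ <
            Torus.euclidDist (z j).1 ((Φ N).flow t z i).1}) atTop (nhds 0)

/-- Sanity: the crux implies the log-loss cone (`√(log (N+2)) ≥ 1` for `N ≥ 1`, so the log-loss event is eventually the
smaller one). -/
theorem gibbsLightConeLogLoss_of_gibbsLightCone
    (h : Summit.AtomisticToContinuum.HydrodynamicLimit.Theses.RelayRaceLocality.GibbsLightCone) :
    GibbsLightConeLogLoss := by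
  intro a θ ha hθ
  obtain ⟨σ₀, hσ₀, c, hc, H⟩ := h a θ ha hθ
  refine ⟨σ₀, hσ₀, c, hc, fun σ hσ hσlt Φ t ht δ hδ => ?_⟩
  have hT := H σ hσ hσlt Φ t ht δ hδ
  refine tendsto_of_tendsto_of_tendsto_of_le_of_le' tendsto_const_nhds hT
    (Eventually.of_forall fun N => bot_le) ?_
  filter_upwards [eventually_ge_atTop 1] with N hN
  refine measure_mono fun z hz => ?_
  simp only [Set.mem_setOf_eq] at hz ⊢
  obtain ⟨i, j, hij, hlt⟩ := hz
  refine ⟨i, j, hij, lt_of_le_of_lt ?_ hlt⟩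
  have hlog : 1 ≤ Real.sqrt (Real.log ((N : ℝ) + 2)) := by
    rw [Real.one_le_sqrt]
    have h2 : Real.exp 1 ≤ (N : ℝ) + 2 := by
      have := Real.exp_one_lt_d9
      have hN' : (1 : ℝ) ≤ N := by exact_mod_cast hN
      linarith
    calc (1 : ℝ) = Real.log (Real.exp 1) := by simp
      _ ≤ Real.log ((N : ℝ) + 2) := Real.log_le_log (Real.exp_pos 1) h2
  have hct : 0 ≤ c * t := mul_nonneg hc.le ht
  nlinarith [mul_le_mul_of_nonneg_left hlog hct]

end Summit.AtomisticToContinuum.HydrodynamicLimit.Cruxes.GibbsLightCone.Seams
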